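import Summits.QuantumFields.BalabanUV.Gaps.D4WalkModelParametrix

/-!
# Spine/NE5/TwoRunPencilParametrix — NE5's two-run pencil THROUGH NODE O's first primitive-letter model: the pencil of two
# parametrix model terms on a shared skeleton IS a parametrix model term over `E × ℂ`, with the primitive letters ×`(1 + τr)`
# (cell `pub-balaban-gaps`, seat `ne5` gen 7; standing offer (s6-a)∕(s7-a) of `HOME/ne/NE5.md`)

WHY.  g1-p2's `Gaps.D4WalkModelParametrix` (p362689 ✓) inhabits row (D4)'s first-missing-lemma shape (v)⁺ by the
PARAMETRIX MODEL: a term datum `ParametrixModelTerm` — skeleton `L` with local inverses `G′_□(u) = L.op □ u`, partition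
`h`, `K′(u)` — whose Γ-slot is the σ-decorated glued inverse `S(1 − R)⁻¹` of [B9] (3.87)–(3.90), with `TermWalkData` from
PRIMITIVE letters (`termWalkData_parametrix`: local-inverse block bound `C_L`, commutator bound `λ_K`, partition ∕ geometry
data, one cube row sum).  Row NE5 compares two runs; its residual (r7) of `ne/NE5.md` asks NODE O for the two runs'
terms as END MEMBERS OF ONE HOLOMORPHIC PENCIL with letters uniform on the reach disc.  THIS FILE supplies that, for the
parametrix model, at the level of the PRIMITIVE DATA: given run A's term `t` and run B's coefficients `opB` (local
inverses) and `K′B` on the SAME skeleton ((x4)), termwise-close in BLOCK currency (`‖G′^B_□ − G′^A_□‖_{y,y′} ≤ r_L·C_L`,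
`‖K^B(h_□) − K^A(h_□)‖_{y,y′} ≤ r_K·λ_K` — rows NE2∕NE3's LOCAL rate, (r4″)), the family over the configuration space
`E × ℂ`, `(u, z) ↦` data_A(u) + `(τ∕R)z`·(data_B(u) − data_A(u)) (T8's `jointWalkExpansion_pencilParam` convention: the
`R`-ball of the sup-normed product covers pencil parameters up to `τ`), IS a `ParametrixModelTerm` over `E × ℂ`
(`pencilTerm`; reference point `(0,0)` = run A at its base point, so the reality fields hold) whose primitive letters are
run A's with `C_L ↦ (1 + τr_L)C_L`, `λ_K ↦ (1 + τr_K)λ_K` (`pencil_hLan ∕ pencil_hLbd ∕ pencil_hKan ∕ pencil_hKbd ∕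
pencil_hKsupp`; the skeleton letters are unchanged).  Hence g1-p2's `termWalkData_parametrix` ∕ `acrossSmall_parametrix`
apply to the pencil term BY NAME: the two runs and every pencil member carry ONE walk package, JOINTLY analytic in
(background, pencil parameter) — (r7)(iv) at the walk layer for NODE O's first primitive-letter model; with `τ = s∕r` the
package is free of the rate (T8 reach form).
* §1 `skelParam`, `pencilOp`, `pencilK`, `pencilTerm` (data; nothing asserted).
* §2 the letters of the pencil term from the two runs' letters + block closeness.
* §3 `commutator_pencil` — `K(h_□)` is LINEAR in `K′`: the pencil's commutator is the pencil of the commutators.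
* §4 `termWalkData_pencil` — g1-p2's `termWalkData_parametrix` on the pencil term BY NAME (one torus-free package; the Neumann
  margin at the inflated letters); `inflate_reach` (τ = s∕r); `analyticOnBall_of_termWalkData` (generic: `TermWalkData` ⇒ the
  Γ-slot and precision entrywise holomorphic in the configuration — for the pencil term, (r7)(iii)'s operator input).

HONEST FRAMING.  Model ∕ mechanism bookkeeping over g1-p2's landed datum; run A's term, run B's coefficients, the rates
`r_L, r_K`, the reach and every letter are HYPOTHESES; nothing of Bałaban's constructed (whether his `G′_□`, `K′` at two
spacings are block-close at rate θ^j is rows NE2∕NE3 + NODE O, instance 0∕1); NE5 NOT PRINTED ∕ NOT PROVED; leaves 0∕12;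
(D4) 0∕1; spine 0∕9.  Rung (B)+1 on a FIXED finite T⁴ — NOT continuum, NOT infinite volume, NOT mass gap, NOT Clay.
HONEST DEPENDENCY: continuum YM on T⁴ ⇐ BetaPertH ∧ nine spine estimates; BetaPertH ⇐ (D1) ∧ (D4) ∧ CAP+tail.  0 sorry.

Sources: [B9] = T. Bałaban, CMP **99** (1985) [Balaban1985BackgroundPropagators] (3.87)–(3.90) p. 409, Thm 3.10 p. 416;
[II] = CMP **116** (1988) [Balaban1988RG2Cluster] (1.5) p. 3, (1.11) p. 5, p. 13, p. 15; C. King, CMP **102** (1986)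
[King1986] p. 665.  Nothing here is a claim about the Yang–Mills mass gap.
-/

noncomputable section

namespace Summit.QuantumFields.BalabanUV.T4Continuum.Spine.NE5.TwoRunPencilParametrix

open Metric Set Finset
open Literature.MathematicalPhysics.QuantumFieldTheory.Balaban1983to89
open Literature.MathematicalPhysics.QuantumFieldTheory.Balaban1983to89.TreeLengthTorus (TPt)
open Literature.MathematicalPhysics.QuantumFieldTheory.Balaban1983to89.B5TorusCover (UT)
open Literature.MathematicalPhysics.QuantumFieldTheory.Balaban1983to89.B13DomainKernelWalks (DomainTerms)
open Literature.MathematicalPhysics.QuantumFieldTheory.Balaban1983to89.B9Thm34Ext (toB6)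
open Literature.MathematicalPhysics.QuantumFieldTheory.Balaban1983to89.B9Thm37GlueTorus (torusGeom tdist1)
open Literature.MathematicalPhysics.QuantumFieldTheory.Balaban1983to89.B11SectG (RowSum)
open Literature.MathematicalPhysics.QuantumFieldTheory.Balaban1983to89.B13TermWalkData (TermKernels TermWalkData WalkConsts)
open Literature.MathematicalPhysics.QuantumFieldTheory.Balaban1983to89.B13JointWalkExpansion (JointWalkExpansion)
open Summit.QuantumFields.BalabanUV.Gaps.D4WalkBlock (blockNorm blockNorm_add_le blockNorm_smul_le blockNorm_nonneg)
open Summit.QuantumFields.BalabanUV.Gaps.D4WalkModelParametrix (ParametrixModelTerm)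
open Summit.QuantumFields.BalabanUV.Beta.UnitLatticeWalkInversion (Hd)

variable {d N' : ℕ} {ν : ℕ} {K : Fin ν → ℕ} [∀ i, NeZero (K i)]
variable {E : Type*} [NormedAddCommGroup E] [NormedSpace ℂ E]

/-! ## §1. The pencil term over `E × ℂ` (data) -/

section Data

variable {p n : Type}

/-- A domain skeleton transported to the configuration space `E × ℂ` with new coefficients (terms index, domains,
anchors, parameter sets kept). [cite: Balaban1985BackgroundPropagators, (3.107) p.416] -/
def skelParam (L : DomainTerms d N' ν K p n E) (op' : L.B → E × ℂ → Matrix p n ℂ) : DomainTerms d N' ν K p n (E × ℂ) where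
  B := L.B
  instFintype := L.instFintype
  dom := L.dom
  anchor := L.anchor
  J := L.J
  op := op'

/-- The pencil of coefficient families: `(u, z) ↦ op_A □ u + (τ∕R)z·(op_B □ u − op_A □ u)`.
[cite: Balaban1988RG2Cluster, (1.5) p.3] -/
def pencilOp {B : Type} (opA opB : B → E → Matrix p n ℂ) (τ R : ℝ) : B → E × ℂ → Matrix p n ℂ :=
  fun b v => opA b v.1 + (((τ / R : ℝ) : ℂ) * v.2) • (opB b v.1 - opA b v.1)

/-- The pencil of the `K′`-families: `(u, z) ↦ K′_A(u) + (τ∕R)z·(K′_B(u) − K′_A(u))`. [cite: Balaban1988RG2Cluster, (1.5) p.3] -/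
def pencilK (KA KB : E → Matrix n n ℂ) (τ R : ℝ) : E × ℂ → Matrix n n ℂ :=
  fun v => KA v.1 + (((τ / R : ℝ) : ℂ) * v.2) • (KB v.1 - KA v.1)

end Data

variable (t : ParametrixModelTerm d N' ν K E) (opB : t.L.B → E → Matrix t.n t.n ℂ) (K'B : E → Matrix t.n t.n ℂ)
  (τ R : ℝ)

/-- **THE PENCIL TERM.**  Run A's parametrix model term `t`, run B's local inverses `opB` and `K′B` on the SAME skeleton,
read as ONE parametrix model term over the configuration space `E × ℂ`: skeleton `t.L` with the pencil coefficients,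
`K′` the pencil of the `K′`, every other field run A's; the reference point `(0, 0)` is run A at its base point, so the
reality fields are run A's.  (`reducible`, so that `(pencilTerm …).n` unfolds to `t.n` for the elaborator.)
[cite: Balaban1985BackgroundPropagators, (3.87)–(3.90) p.409; Balaban1988RG2Cluster, (1.5) p.3, p.15] -/
@[reducible] def pencilTerm : ParametrixModelTerm d N' ν K (E × ℂ) where
  n := t.n
  cubn := t.cubn
  X := t.X
  L := skelParam t.L (pencilOp t.L.op opB τ R)
  h := t.h
  Es := t.Es
  K' := pencilK t.K' K'B τ R
  hrealL b i j := by
    show ((t.L.op b (0 : E × ℂ).1 + (((τ / R : ℝ) : ℂ) * (0 : E × ℂ).2) • (opB b (0 : E × ℂ).1 - t.L.op b (0 : E × ℂ).1))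
      i j).im = 0
    simp [t.hrealL]
  hrealK i j := by
    show ((t.K' (0 : E × ℂ).1 + (((τ / R : ℝ) : ℂ) * (0 : E × ℂ).2) • (K'B (0 : E × ℂ).1 - t.K' (0 : E × ℂ).1)) i j).im = 0
    simp [t.hrealK]
  Λ := t.Λ
  C₀ := t.C₀
  rowOf := t.rowOf
  colOf := t.colOf
  m := t.m
  hfib := t.hfib

/-- The pencil term's skeleton data are run A's (definitionally). [folklore] -/
theorem pencilTerm_dom (b : t.L.B) : (pencilTerm t opB K'B τ R).L.dom b = t.L.dom b := rfl

/-- The pencil term's coefficient is the pencil of the coefficients (definitionally). [folklore] -/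
theorem pencilTerm_op (b : t.L.B) (v : E × ℂ) :
    (pencilTerm t opB K'B τ R).L.op b v = t.L.op b v.1 + (((τ / R : ℝ) : ℂ) * v.2) • (opB b v.1 - t.L.op b v.1) := rfl

/-- The pencil term's `K′` is the pencil of the `K′` (definitionally). [folklore] -/
theorem pencilTerm_K' (v : E × ℂ) :
    (pencilTerm t opB K'B τ R).K' v = t.K' v.1 + (((τ / R : ℝ) : ℂ) * v.2) • (K'B v.1 - t.K' v.1) := rfl

/-! ## §2. The letters of the pencil term -/

section Letters

variable {t opB K'B τ R}

omit [∀ i, NeZero (K i)] [NormedSpace ℂ E] in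
/-- On the `R`-ball of `E × ℂ` (sup norm) the first coordinate is in the `R`-ball of `E`. [folklore] -/
private theorem fst_mem_ball {v : E × ℂ} (hv : v ∈ ball (0 : E × ℂ) R) : v.1 ∈ ball (0 : E) R := by
  rw [mem_ball_zero_iff] at hv ⊢
  exact (norm_fst_le v).trans_lt hv

omit [∀ i, NeZero (K i)] [NormedSpace ℂ E] in
/-- On the `R`-ball of `E × ℂ` the rescaled second coordinate has norm `≤ τ` (`τ ≥ 0`). [folklore] -/
private theorem norm_coef_le (hτ : 0 ≤ τ) {v : E × ℂ} (hv : v ∈ ball (0 : E × ℂ) R) :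
    ‖((τ / R : ℝ) : ℂ) * v.2‖ ≤ τ := by
  rw [mem_ball_zero_iff] at hv
  have hR : 0 < R := (norm_nonneg v).trans_lt hv
  have h2 : ‖v.2‖ ≤ R := (norm_snd_le v).trans hv.le
  rw [norm_mul, Complex.norm_real, Real.norm_of_nonneg (div_nonneg hτ hR.le)]
  calc τ / R * ‖v.2‖ ≤ τ / R * R := by gcongr
    _ = τ := div_mul_cancel₀ τ hR.ne'

/-- A block pencil estimate: `‖a + c(b − a)‖_{y,y′} ≤ (1 + τr)·m` from `‖a‖ ≤ m`, `‖b − a‖ ≤ r·m`, `‖c‖ ≤ τ`.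
[cite: Balaban1985BackgroundPropagators, (3.108) p.416] (elementary API) -/
private theorem blockNorm_pencil {MA MB : Matrix t.n t.n ℂ} {cc : ℂ} {m r τ' : ℝ} (y y' : UT K)
    (hA : blockNorm t.cubn t.cubn MA y y' ≤ m) (hAB : blockNorm t.cubn t.cubn (MB - MA) y y' ≤ r * m) (hc : ‖cc‖ ≤ τ') :
    blockNorm t.cubn t.cubn (MA + cc • (MB - MA)) y y' ≤ (1 + τ' * r) * m :=
  calc blockNorm t.cubn t.cubn (MA + cc • (MB - MA)) y y'
      ≤ blockNorm t.cubn t.cubn MA y y' + blockNorm t.cubn t.cubn (cc • (MB - MA)) y y' :=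
        blockNorm_add_le t.cubn t.cubn _ _ y y'
    _ ≤ m + ‖cc‖ * blockNorm t.cubn t.cubn (MB - MA) y y' :=
        add_le_add hA (blockNorm_smul_le t.cubn t.cubn cc _ y y')
    _ ≤ m + τ' * (r * m) :=
        add_le_add_right (mul_le_mul hc hAB (blockNorm_nonneg t.cubn t.cubn _ y y') ((norm_nonneg cc).trans hc)) m
    _ = (1 + τ' * r) * m := by ring

/-- **Analyticity of the pencil's local inverses in (background, pencil parameter)** on the `R`-ball of `E × ℂ`, from the
two runs' entrywise analyticity on the `R`-ball of `E`. [cite: Balaban1988RG2Cluster, p.15] -/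
theorem pencil_hLan (hA : ∀ b i j, DifferentiableOn ℂ (fun u => t.L.op b u i j) (ball (0 : E) R))
    (hB : ∀ b i j, DifferentiableOn ℂ (fun u => opB b u i j) (ball (0 : E) R)) :
    ∀ b i j, DifferentiableOn ℂ (fun v => (pencilTerm t opB K'B τ R).L.op b v i j) (ball (0 : E × ℂ) R) := by
  intro b i j
  have hmaps : MapsTo (fun v : E × ℂ => v.1) (ball (0 : E × ℂ) R) (ball (0 : E) R) := fun v hv => fst_mem_ball hv
  have h1 : DifferentiableOn ℂ (fun v : E × ℂ => t.L.op b v.1 i j) (ball (0 : E × ℂ) R) :=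
    (hA b i j).comp differentiableOn_fst hmaps
  have h2 : DifferentiableOn ℂ (fun v : E × ℂ => opB b v.1 i j) (ball (0 : E × ℂ) R) :=
    (hB b i j).comp differentiableOn_fst hmaps
  have hc : DifferentiableOn ℂ (fun v : E × ℂ => ((τ / R : ℝ) : ℂ) * v.2) (ball (0 : E × ℂ) R) :=
    differentiableOn_snd.const_mul _
  exact h1.add (hc.mul (h2.sub h1))

/-- **The local-inverse block bound along the pencil**: run A's `C_L` on the ball and block closeness `r_L·C_L` give
`(1 + τr_L)·C_L` for every pencil member in the `R`-ball of `E × ℂ` (print's (1.5): *"operators … satisfying the same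
bounds"*; Cor 3.6 ∕ (3.42) letter). [cite: Balaban1988RG2Cluster, (1.5) p.3; Balaban1985BackgroundPropagators, Thm 3.10 p.416] -/
theorem pencil_hLbd {CL rL : ℝ} (hτ : 0 ≤ τ)
    (hA : ∀ b, ∀ u ∈ ball (0 : E) R, ∀ y y', blockNorm t.cubn t.cubn (t.L.op b u) y y' ≤ CL)
    (hAB : ∀ b, ∀ u ∈ ball (0 : E) R, ∀ y y', blockNorm t.cubn t.cubn (opB b u - t.L.op b u) y y' ≤ rL * CL) :
    ∀ b, ∀ v ∈ ball (0 : E × ℂ) R, ∀ y y',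
      blockNorm t.cubn t.cubn ((pencilTerm t opB K'B τ R).L.op b v) y y' ≤ (1 + τ * rL) * CL := by
  intro b v hv y y'
  rw [pencilTerm_op]
  exact blockNorm_pencil y y' (hA b v.1 (fst_mem_ball hv) y y') (hAB b v.1 (fst_mem_ball hv) y y') (norm_coef_le hτ hv)

/-- **Analyticity of the pencil's `K′` in (background, pencil parameter)**. [cite: Balaban1988RG2Cluster, p.15] -/
theorem pencil_hKan (hA : ∀ i j, DifferentiableOn ℂ (fun u => t.K' u i j) (ball (0 : E) R))
    (hB : ∀ i j, DifferentiableOn ℂ (fun u => K'B u i j) (ball (0 : E) R)) :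
    ∀ i j, DifferentiableOn ℂ (fun v => (pencilTerm t opB K'B τ R).K' v i j) (ball (0 : E × ℂ) R) := by
  intro i j
  have hmaps : MapsTo (fun v : E × ℂ => v.1) (ball (0 : E × ℂ) R) (ball (0 : E) R) := fun v hv => fst_mem_ball hv
  have h1 : DifferentiableOn ℂ (fun v : E × ℂ => t.K' v.1 i j) (ball (0 : E × ℂ) R) :=
    (hA i j).comp differentiableOn_fst hmaps
  have h2 : DifferentiableOn ℂ (fun v : E × ℂ => K'B v.1 i j) (ball (0 : E × ℂ) R) :=
    (hB i j).comp differentiableOn_fst hmaps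
  have hc : DifferentiableOn ℂ (fun v : E × ℂ => ((τ / R : ℝ) : ℂ) * v.2) (ball (0 : E × ℂ) R) :=
    differentiableOn_snd.const_mul _
  exact h1.add (hc.mul (h2.sub h1))

/-! ### §3. The commutator `K(h_□) = h_□K′ − K′h_□` is linear in `K′` -/

/-- **The pencil's commutator is the pencil of the commutators**: `[H_□, K′_A + c(K′_B − K′_A)] = [H_□, K′_A] + c([H_□, K′_B]
− [H_□, K′_A])`. [cite: Balaban1985BackgroundPropagators, (3.88) p.409] (elementary API) -/
theorem commutator_pencil (H KA KB : Matrix t.n t.n ℂ) (cc : ℂ) :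
    H * (KA + cc • (KB - KA)) - (KA + cc • (KB - KA)) * H =
      (H * KA - KA * H) + cc • ((H * KB - KB * H) - (H * KA - KA * H)) := by
  simp only [Matrix.mul_add, Matrix.add_mul, Matrix.mul_smul, Matrix.smul_mul, Matrix.mul_sub, Matrix.sub_mul,
    smul_sub]
  abel

/-- **The commutator block bound along the pencil**: run A's `λ_K` and block closeness `r_K·λ_K` of the two runs'
commutators give `(1 + τr_K)·λ_K` for every pencil member (print: *"K(h_□) = O(M⁻¹)"*, (3.88) — the letter carrying the
Neumann margin). [cite: Balaban1985BackgroundPropagators, (3.88) p.409; Balaban1988RG2Cluster, (1.5) p.3] -/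
theorem pencil_hKbd {lamK rK : ℝ} (hτ : 0 ≤ τ)
    (hA : ∀ b, ∀ u ∈ ball (0 : E) R, ∀ y y',
      blockNorm t.cubn t.cubn (Hd t.h b * t.K' u - t.K' u * Hd t.h b) y y' ≤ lamK)
    (hAB : ∀ b, ∀ u ∈ ball (0 : E) R, ∀ y y',
      blockNorm t.cubn t.cubn ((Hd t.h b * K'B u - K'B u * Hd t.h b) - (Hd t.h b * t.K' u - t.K' u * Hd t.h b)) y y'
        ≤ rK * lamK) :
    ∀ b, ∀ v ∈ ball (0 : E × ℂ) R, ∀ y y',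
      blockNorm t.cubn t.cubn (Hd (pencilTerm t opB K'B τ R).h b * (pencilTerm t opB K'B τ R).K' v -
        (pencilTerm t opB K'B τ R).K' v * Hd (pencilTerm t opB K'B τ R).h b) y y' ≤ (1 + τ * rK) * lamK := by
  intro b v hv y y'
  show blockNorm t.cubn t.cubn (Hd t.h b * (pencilTerm t opB K'B τ R).K' v -
    (pencilTerm t opB K'B τ R).K' v * Hd t.h b) y y' ≤ (1 + τ * rK) * lamK
  rw [pencilTerm_K', commutator_pencil]
  exact blockNorm_pencil y y' (hA b v.1 (fst_mem_ball hv) y y') (hAB b v.1 (fst_mem_ball hv) y y') (norm_coef_le hτ hv)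

/-- **Support of the pencil's commutators inside the domains** from the two runs' support property: a block of
`(1 − c)·comm_A + c·comm_B` that is non-zero forces one of the two blocks to be non-zero. [cite: Balaban1985BackgroundPropagators, (3.88) p.409] -/
theorem pencil_hKsupp
    (hA : ∀ b u y y', blockNorm t.cubn t.cubn (Hd t.h b * t.K' u - t.K' u * Hd t.h b) y y' ≠ 0 →
      y ∈ t.L.dom b ∧ y' ∈ t.L.dom b)
    (hB : ∀ b u y y', blockNorm t.cubn t.cubn (Hd t.h b * K'B u - K'B u * Hd t.h b) y y' ≠ 0 →
      y ∈ t.L.dom b ∧ y' ∈ t.L.dom b) :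
    ∀ b v y y', blockNorm t.cubn t.cubn (Hd (pencilTerm t opB K'B τ R).h b * (pencilTerm t opB K'B τ R).K' v -
        (pencilTerm t opB K'B τ R).K' v * Hd (pencilTerm t opB K'B τ R).h b) y y' ≠ 0 →
      y ∈ (pencilTerm t opB K'B τ R).L.dom b ∧ y' ∈ (pencilTerm t opB K'B τ R).L.dom b := by
  intro b v y y' hne
  show y ∈ t.L.dom b ∧ y' ∈ t.L.dom b
  by_contra hout
  apply hne
  show blockNorm t.cubn t.cubn (Hd t.h b * (pencilTerm t opB K'B τ R).K' v -
    (pencilTerm t opB K'B τ R).K' v * Hd t.h b) y y' = 0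
  -- both runs' commutator blocks vanish at (y, y′)
  have hA0 : blockNorm t.cubn t.cubn (Hd t.h b * t.K' v.1 - t.K' v.1 * Hd t.h b) y y' = 0 := by
    by_contra h; exact hout (hA b v.1 y y' h)
  have hB0 : blockNorm t.cubn t.cubn (Hd t.h b * K'B v.1 - K'B v.1 * Hd t.h b) y y' = 0 := by
    by_contra h; exact hout (hB b v.1 y y' h)
  set cc : ℂ := ((τ / R : ℝ) : ℂ) * v.2 with hcc
  -- the pencil commutator as `(1 − c)·comm_A + c·comm_B`
  have hid : Hd t.h b * (pencilTerm t opB K'B τ R).K' v - (pencilTerm t opB K'B τ R).K' v * Hd t.h b =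
      (1 - cc) • (Hd t.h b * t.K' v.1 - t.K' v.1 * Hd t.h b) + cc • (Hd t.h b * K'B v.1 - K'B v.1 * Hd t.h b) := by
    rw [pencilTerm_K', commutator_pencil, smul_sub, sub_smul, one_smul]
    abel
  rw [hid]
  refine le_antisymm ?_ (blockNorm_nonneg t.cubn t.cubn _ y y')
  calc blockNorm t.cubn t.cubn ((1 - cc) • (Hd t.h b * t.K' v.1 - t.K' v.1 * Hd t.h b) +
        cc • (Hd t.h b * K'B v.1 - K'B v.1 * Hd t.h b)) y y'
      ≤ blockNorm t.cubn t.cubn ((1 - cc) • (Hd t.h b * t.K' v.1 - t.K' v.1 * Hd t.h b)) y y' +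
          blockNorm t.cubn t.cubn (cc • (Hd t.h b * K'B v.1 - K'B v.1 * Hd t.h b)) y y' :=
        blockNorm_add_le t.cubn t.cubn _ _ y y'
    _ ≤ ‖1 - cc‖ * blockNorm t.cubn t.cubn (Hd t.h b * t.K' v.1 - t.K' v.1 * Hd t.h b) y y' +
          ‖cc‖ * blockNorm t.cubn t.cubn (Hd t.h b * K'B v.1 - K'B v.1 * Hd t.h b) y y' :=
        add_le_add (blockNorm_smul_le t.cubn t.cubn _ _ y y') (blockNorm_smul_le t.cubn t.cubn _ _ y y')
    _ = 0 := by rw [hA0, hB0, mul_zero, mul_zero, add_zero]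

end Letters

/-! ## §4. The END by name: g1-p2's `termWalkData_parametrix` on the pencil term -/

section End

variable {t opB K'B τ R}

/-- **ONE WALK PACKAGE FOR THE WHOLE TWO-RUN PENCIL OF THE PARAMETRIX MODEL** (g1-p2's `termWalkData_parametrix` applied to
`pencilTerm` BY NAME): from run A's primitive letters, run B's analyticity, the BLOCK closeness of the two runs' local
inverses (`r_L·C_L`) and commutators (`r_K·λ_K`), and the same skeleton ∕ partition ∕ geometry ∕ row-sum data, the
pencil term over `E × ℂ` has `TermWalkData` with the torus-free package of `termWalkData_parametrix` in which
`C_L ↦ (1 + τr_L)C_L` and `λ_K ↦ (1 + τr_K)λ_K` — in particular the Neumann margin `q < 1` is asked at the inflated letters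
(print: *"α₅ sufficiently small"*, [II] p. 17; here `O(λ_K(1 + τr_K)·C_L(1 + τr_L))`).  With `τ = s∕r` (T8 reach form) the
package is free of the two-run rate: (r7)(iv) of `ne/NE5.md` at the walk layer for NODE O's first primitive-letter model,
JOINTLY in (background, pencil parameter). [cite: Balaban1985BackgroundPropagators, (3.87)–(3.90) p.409, Thm 3.10 p.416; Balaban1988RG2Cluster, (1.5) p.3, p.13, p.15, p.17] -/
theorem termWalkData_pencil (c : B13.Consts) {CL lamK r rL rK : ℝ} {mJ nD nC : ℕ} {ρ₀ ε₀ κ₀ μ cμ Rσ : ℝ}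
    (hτ : 0 ≤ τ)
    (hanchor : ∀ b, t.L.anchor b ∈ t.L.dom b) (hdiam : ∀ b, ∀ z ∈ t.L.dom b, ∀ z' ∈ t.L.dom b, tdist1 K z z' ≤ r)
    (hJ : ∀ b, (t.L.J b).card ≤ mJ) (hX : ∀ b, (t.L.J b).Nonempty → (t.L.dom b ∩ t.X).Nonempty)
    (hmult : ∀ z : UT K, (Finset.univ.filter fun b => t.L.anchor b = z).card ≤ nD)
    (hsupp : ∀ b y, y ∉ t.Es b → t.h b y = 0) (habs : ∀ b y, |t.h b y| ≤ 1)
    (hE : ∀ b y, y ∈ t.Es b → t.cubn y ∈ t.L.dom b)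
    (hLanA : ∀ b i j, DifferentiableOn ℂ (fun u => t.L.op b u i j) (ball (0 : E) R))
    (hLanB : ∀ b i j, DifferentiableOn ℂ (fun u => opB b u i j) (ball (0 : E) R))
    (hLbd : ∀ b, ∀ u ∈ ball (0 : E) R, ∀ y y', blockNorm t.cubn t.cubn (t.L.op b u) y y' ≤ CL)
    (hLdiff : ∀ b, ∀ u ∈ ball (0 : E) R, ∀ y y', blockNorm t.cubn t.cubn (opB b u - t.L.op b u) y y' ≤ rL * CL)
    (hCL : 0 ≤ CL) (hrL : 0 ≤ rL)
    (hKanA : ∀ i j, DifferentiableOn ℂ (fun u => t.K' u i j) (ball (0 : E) R))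
    (hKanB : ∀ i j, DifferentiableOn ℂ (fun u => K'B u i j) (ball (0 : E) R))
    (hKbd : ∀ b, ∀ u ∈ ball (0 : E) R, ∀ y y',
      blockNorm t.cubn t.cubn (Hd t.h b * t.K' u - t.K' u * Hd t.h b) y y' ≤ lamK)
    (hKdiff : ∀ b, ∀ u ∈ ball (0 : E) R, ∀ y y',
      blockNorm t.cubn t.cubn ((Hd t.h b * K'B u - K'B u * Hd t.h b) - (Hd t.h b * t.K' u - t.K' u * Hd t.h b)) y y'
        ≤ rK * lamK)
    (hlamK : 0 ≤ lamK) (hrK : 0 ≤ rK)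
    (hKsuppA : ∀ b u y y', blockNorm t.cubn t.cubn (Hd t.h b * t.K' u - t.K' u * Hd t.h b) y y' ≠ 0 →
      y ∈ t.L.dom b ∧ y' ∈ t.L.dom b)
    (hKsuppB : ∀ b u y y', blockNorm t.cubn t.cubn (Hd t.h b * K'B u - K'B u * Hd t.h b) y y' ≠ 0 →
      y ∈ t.L.dom b ∧ y' ∈ t.L.dom b)
    (hcard : ∀ b, (t.L.dom b).card ≤ nC)
    (hκ₁ : 0 ≤ c.κ₁) (hμ : 0 ≤ μ) (hμε : 3 * μ ≤ ε₀) (hμκ : 2 * μ ≤ κ₀) (hwin : κ₀ + μ ≤ ρ₀ - ε₀) (hcμ : 0 ≤ cμ)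
    (hrow : RowSum (toB6 (torusGeom K 0 0 0) 0 True) μ cμ)
    (hq : cμ * (cμ * 1 *
      (1 * (((nC * ((1 + τ * rK) * lamK) * ((1 + τ * rL) * CL)) * Real.exp (c.κ₁ * mJ) * Real.exp (2 * ρ₀ * r)) *
        Real.exp (μ * r) * (nD * cμ))) * cμ) * cμ < 1)
    (hfar : ∀ b : t.Λ, ∀ z ∈ t.X, Rσ ≤ tdist1 K (t.cubn (t.rowOf b)) z) :
    TermWalkData ((pencilTerm t opB K'B τ R).toKernels c)
      ⟨R, ε₀ - 3 * μ, κ₀ - 2 * μ,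
        cμ * ((((1 + τ * rL) * CL) * Real.exp (c.κ₁ * mJ) * Real.exp (2 * ρ₀ * r)) * Real.exp (μ * r) * (nD * cμ)) *
          (1 * (1 - cμ * (cμ * 1 *
            (1 * (((nC * ((1 + τ * rK) * lamK) * ((1 + τ * rL) * CL)) * Real.exp (c.κ₁ * mJ) * Real.exp (2 * ρ₀ * r)) *
              Real.exp (μ * r) * (nD * cμ))) * cμ) * cμ)⁻¹) * cμ,
        1, 1, Rσ⟩ :=
  ParametrixModelTerm.termWalkData_parametrix (c := c) (t := pencilTerm t opB K'B τ R) hanchor hdiam hJ hX hmult hsupp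
    habs hE (pencil_hLan hLanA hLanB) (pencil_hLbd hτ hLbd hLdiff) (mul_nonneg (by positivity) hCL)
    (pencil_hKan hKanA hKanB) (pencil_hKbd hτ hKbd hKdiff) (mul_nonneg (by positivity) hlamK)
    (pencil_hKsupp hKsuppA hKsuppB) hcard hκ₁ hμ hμε hμκ hwin hcμ hrow hq hfar

/-- **Reach form** (T8 `jointWalkExpansion_pencil_reach` at the primitive level): with `τ := s ∕ r₀` for a common rate
`r_L = r_K = r₀ > 0` of the two runs' primitive data, the inflated letters are `(1 + s)C_L`, `(1 + s)λ_K` — free of the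
rate; the pencil parameters up to `s∕r₀` (both runs at `(τ∕R)z = 0, 1` once `r₀ ≤ s`) carry ONE package while `r₀ = θ^j → 0`.
[cite: Balaban1988RG2Cluster, (1.5) p.3, (2.16) p.16] -/
theorem inflate_reach {s r₀ : ℝ} (hr : 0 < r₀) (X : ℝ) : (1 + s / r₀ * r₀) * X = (1 + s) * X := by
  rw [div_mul_cancel₀ s hr.ne']

/-- **Projection for (r7)(iii)** (generic, any term kernel datum): `TermWalkData` makes the Γ-slot and the precision
ENTRYWISE HOLOMORPHIC in the configuration on the `R`-ball (`JointWalkExpansion.analyticOnBall` on the `∃`-packaged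
witnesses).  For the pencil term over `E × ℂ` this is JOINT holomorphy in (background, pencil parameter) — the
operator-holomorphy input of T11 `B13Core214Holomorphic.differentiableOn_core214X` along NE5's pencil, by name.
[cite: Balaban1988RG2Cluster, p.15; Balaban1985BackgroundPropagators, Thm 3.10 p.416] -/
theorem analyticOnBall_of_termWalkData {E' : Type*} [NormedAddCommGroup E'] [NormedSpace ℂ E'] {c : B13.Consts}
    {𝒦 : TermKernels c d N' ν K E'} {w : WalkConsts} (h : TermWalkData 𝒦 w) (hε : 0 ≤ w.ε) :
    JointWalkExpansion.AnalyticOnBall c 𝒦.G2 w.R ∧ JointWalkExpansion.AnalyticOnBall c 𝒦.A2 w.R := by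
  obtain ⟨W, T, SX, A, D, ρ, hΓ⟩ := h.hΓ
  obtain ⟨W', T', SX', A', D', ρ', hE⟩ := h.hE
  exact ⟨hΓ.analyticOnBall hε, hE.analyticOnBall hε⟩

end End

end Summit.QuantumFields.BalabanUV.T4Continuum.Spine.NE5.TwoRunPencilParametrix

end
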